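import Mathlib
import Summits.Ventures.HodgeRepro.Tier4.Line4.KTypeIntegers
import Summits.Ventures.HodgeRepro.Tier4.Line4.LocalTorusSurj

/-!
# Tier4/Line4/KTypeIntegersSurj — the INTEGERS FORM of the K-type identity WITHOUT the surjectivity hypothesis: at
`g = g′ = 1` the K-type conjunct of `hF` is EXACTLY `∀ w, eP′ w = eP w ∧ eM′ w = eM w` (KTypeIntegers' (6) with its
displayed `hsurj` discharged by LocalTorusSurj's `localTorus_surj_seesaw_one`)

Blind re-derivation cell `pub-hodge-repro`, Tier 4 «prove the step» (README §9–§10), seat t4-L1-p4 (gen 6), LINE L4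
(cut C-L4-LOCAL-TORUS-SURJ, S16393 / S16408).  Target tree path
`lean/Summits/Ventures/HodgeRepro/Tier4/Line4/KTypeIntegersSurj.lean`.  Imports: Mathlib + `Line4/KTypeIntegers`
(p719550: `forall_chi_mul_torusWeight'_inv_eq_one_iff_integers`) + `Line4/LocalTorusSurj` (p719957:
`localTorus_surj_seesaw_one`).  ONE theorem, the bind; no definition; no literature.

READING (the M5 `hF` risk row, R-48-HF-KTYPE): KTypeIntegers' (5) is the WEIGHTS form, kernel-only; its (6) was the
INTEGERS form conditional on the displayed `hsurj` (local-torus surjectivity, the `T_w ≅ U(1) × U(1)` fact).  With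
`hsurj` a theorem, the integers form holds under (6)'s other binders alone: `hall ha0 ha2 ha1 ha3 hchi` and the
isometry data `lam hlam hiso` of the identity instance.  NOTHING is claimed about the dictionary's integers
`(eP, eM)`, `(eP′, eM′)` themselves — the finite check of the K-type identity is on those two weight pairs.
Nothing here says anything about the status of the Hodge conjecture for CM abelian varieties, which is NOT proved
(HC_CM is NOT proved by anyone in this repository).
-/

set_option autoImplicit false

noncomputable section

namespace Summit.Ventures.HodgeRepro.Tier4.Line4

open Summit.Ventures.HodgeRepro.Tier4.Common Summit.Ventures.HodgeRepro.Tier4.Line1 NumberField Matrix MeasureTheory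

open scoped ComplexConjugate

open scoped Classical

section Identity3

variable {k : Type} [Field k] [NumberField k] (q : QuadData k) (a : Fin 4 → k)
  (hgg' : (1 : Matrix (Fin 4) (Fin 4) k) * 1 = 1) (hg'g : (1 : Matrix (Fin 4) (Fin 4) k) * 1 = 1)
  (hgΩ : (1 : Matrix (Fin 4) (Fin 4) k) * (PlaneData.mixedRow q (a 0) (a 2)).Ω = (PlaneData.mixedRow q (a 0) (a 2)).Ω * 1)
  (lam : k) (hlam : lam ≠ 0)
  (hiso : (1 : Matrix (Fin 4) (Fin 4) k) * (PlaneData.mixedRow q (a 1) (a 3)).B * (1 : Matrix (Fin 4) (Fin 4) k)ᵀ =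
    lam • (PlaneData.mixedRow q (a 0) (a 2)).B)
  (eP eM eP' eM' : InfinitePlace k → ℤ)

include lam hlam hiso in
/-- **THE INTEGERS FORM, hypothesis `hsurj` DISCHARGED**: at `g = g′ = 1`, under `hall` (every infinite place real and
CM), `a i ≠ 0`, and the wall's `_hchi` at every place, the K-type identity of `integral_chi_archWitnessOf_ne_zero_iff_of_one`
is EXACTLY `∀ w, eP′ w = eP w ∧ eM′ w = eM w` — KTypeIntegers' `forall_chi_mul_torusWeight'_inv_eq_one_iff_integers`
with LocalTorusSurj's `localTorus_surj_seesaw_one q a hgg' hg'g hgΩ hall` in the `hsurj` slot. -/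
theorem forall_chi_mul_torusWeight'_inv_eq_one_iff_integers' [MeasurableSpace (GA ((PlaneData.mixedRow q (a 0) (a 2)).withTransportedTorus 1 1 hgg' hg'g hgΩ))] (R : RTFData ((PlaneData.mixedRow q (a 0) (a 2)).withTransportedTorus 1 1 hgg' hg'g hgΩ))
    (hall : ∀ w : InfinitePlace k, w.IsReal ∧ IsCMAt q w) (ha0 : a 0 ≠ 0) (ha2 : a 2 ≠ 0) (ha1 : a 1 ≠ 0)
    (ha3 : a 3 ≠ 0) (hchi : ∀ w, ChiMatchesAt ((PlaneData.mixedRow q (a 0) (a 2)).withTransportedTorus 1 1 hgg' hg'g hgΩ) q w (eP w) (eM w) R.chi) :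
    (∀ t : torusInf ((PlaneData.mixedRow q (a 0) (a 2)).withTransportedTorus 1 1 hgg' hg'g hgΩ), R.chi t * torusWeight' q a 1 1 hgg' hg'g hgΩ eP' eM' (((t : torusT ((PlaneData.mixedRow q (a 0) (a 2)).withTransportedTorus 1 1 hgg' hg'g hgΩ)) : GA ((PlaneData.mixedRow q (a 0) (a 2)).withTransportedTorus 1 1 hgg' hg'g hgΩ)))⁻¹ = 1) ↔
      ∀ w : InfinitePlace k, eP' w = eP w ∧ eM' w = eM w :=
  forall_chi_mul_torusWeight'_inv_eq_one_iff_integers q a hgg' hg'g hgΩ lam hlam hiso eP eM eP' eM' R hall ha0 ha2 ha1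
    ha3 hchi (localTorus_surj_seesaw_one q a hgg' hg'g hgΩ hall)

end Identity3

end Summit.Ventures.HodgeRepro.Tier4.Line4

end
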